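import Literature.NumberTheory.GaloisRepresentations.BrauerHassePrinciple
import Literature.NumberTheory.GaloisRepresentations.TateH2VanishingGlobalAssembly
import Literature.NumberTheory.GaloisRepresentations.GaloisCohomologyKummerProofs
import HarnessLib

/-!
# Poitou–Tate toolkit: `Ш²(K, μₙ) = 0` — a class of `H²(K, μₙ)` which vanishes at every place of
# the number field `K` vanishes (Brauer–Hasse–Noether for `Br(K)[n]` and Hilbert 90)

Cell `bsd-schneider-ideate`, seat `bsd-schneider-door-c6` (prover, generation 7).  PARTITION: board row
B6 ∩ X3 ∩ sst-twist, `r = 1` — CONTROL corner (crux `AnticycControlAdditiveK`, stmt-BirchSwinnertonDyer-19295;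
the registered stubs hinge on Poitou–Tate for ALL finite `M`).  THEOREMS ONLY.  HONEST FRAMING: the
degree-`2` local–global principle for the module `μₙ` (the `r = 2`, `M = μₙ` instance of the injectivity
`Ш²(K, M) ↪ Ш¹(K, M^D)^*` of the Poitou–Tate sequence, here with `Ш¹(K, ℤ/n) = 0` absorbed); it is the
obstruction group met by any dévissage of Milne I Thm. 4.10(b) along `0 → μₙ → B → C → 0`
(FINDING-door-c6-g7 §4); no case of BSD.

* `galoisCohomology_mu_two_eq_zero_of_localization_eq_zero` — for `x ∈ H²(K, μₙ)` with `loc_v x = 0` at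
  every finite and every infinite place `v`: `x = 0`.  Proof: on an inhomogeneous continuous cocycle `c`
  of `x`, the unit-valued cocycle `e = muVal ∘ c : Γ_K² → K̄ˣ` is locally a coboundary at every completion
  (the local bounding cochains of `loc_v x = 0`, read in `K̄_vˣ` through `absClosureEmbedding`), hence a
  coboundary `e = ∂b` over `K` by the tree's Brauer–Hasse–Noether theorem
  (`twoCocycle_cob_of_locallyTrivial`, Cassels–Fröhlich VII §9.6/§10); as `eⁿ = 1`, `σ ↦ b(σ)ⁿ` is a
  locally constant `1`-cocycle, `= σβ/β` by Hilbert 90 (`exists_eq_smul_div_of_isLocallyConstant_cocycle`);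
  with `αⁿ = β`, `b'(σ) = b(σ)·α/σα` is `μₙ`-valued, continuous, and `∂b' = ∂b = e`, so `[c] = 0`.

References: [CasselsFrohlichANT1967] VII §9.6, §10; [MilneADT2006] I Thm. 4.10 (the group `Ш²`);
[SerreLocalFields1979] X §1 Prop. 2 (Hilbert 90).
-/

noncomputable section

open CategoryTheory Function NumberField IsDedekindDomain Field
open scoped NumberField

set_option linter.dupNamespace false
set_option autoImplicit false

namespace Summit.BirchSwinnertonDyer.BirchSwinnertonDyer.Theorems.SchneiderFreeAdditiveX3.PoitouTateReduction

open _root_.TopRep _root_.ContRepresentation _root_.ContinuousCohomology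
open Literature.NumberTheory.GaloisRepresentations
open Literature.NumberTheory.GaloisRepresentations.DiscreteGaloisModule

variable {K : Type} [Field K] [NumberField K] {n : ℕ} [NeZero n]

/-- A commutative-group identity used to compare two coboundaries. [folklore] -/
private theorem coboundary_identity {G : Type*} [CommGroup G] (x y z a s t : G) :
    y * s / t / (z * a / t) * (x * a / s) = x * y / z := by
  apply Additive.ofMul.injective
  simp only [ofMul_mul, ofMul_div]
  abel

omit [NeZero n] in
/-- **Local triviality in the Brauer–Hasse–Noether dialect**: if the localisation at a place `v` of the
class of a continuous `2`-cocycle `c` of `μₙ` vanishes, the unit-valued cocycle `muVal ∘ c`, restricted to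
`Γ_{K_v}` and read in `K̄_vˣ`, is the coboundary of a locally constant cochain.
[cite: SerreGaloisCohomology1997, I §2.3] -/
theorem exists_local_cochain_of_localization_twoCocycleClass_eq_zero
    (c : contTwoCocycles (mu K n).toTopRep) (v : Place K)
    (hv : galoisCohomology.localization (mu K n) v 2
      (haveI : CompactSpace (absoluteGaloisGroup K) := absoluteGaloisGroup_compactSpace K
       twoCocycleClass (mu K n).toTopRep c) = 0) :
    ∃ b : absoluteGaloisGroup (Place.Completion v) → (AlgebraicClosure (Place.Completion v))ˣ,
      IsLocallyConstant b ∧ ∀ x y,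
        Units.map (absClosureEmbedding K (Place.Completion v) :
            AlgebraicClosure K →* AlgebraicClosure (Place.Completion v))
          (muVal K n (c.1 (absGaloisRestrict K (Place.Completion v) x, absGaloisRestrict K (Place.Completion v) y))) =
        b x * x • b y / b (x * y) := by
  haveI : CompactSpace (absoluteGaloisGroup K) := absoluteGaloisGroup_compactSpace K
  haveI : CompactSpace (absoluteGaloisGroup (Place.Completion (K := K) v)) := absoluteGaloisGroup_compactSpace _
  rw [galoisCohomology.localization_apply_eq, map_twoCocycleClass] at hv
  obtain ⟨b₀, hb₀⟩ := (twoCocycleClass_eq_zero_iff _ _).1 hv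
  have hb₀lc : IsLocallyConstant (b₀ : absoluteGaloisGroup (Place.Completion (K := K) v) → MuCarrier K n) :=
    (IsLocallyConstant.iff_continuous _).2 b₀.continuous
  refine ⟨fun x => Units.map (absClosureEmbedding K (Place.Completion (K := K) v) :
      AlgebraicClosure K →* AlgebraicClosure (Place.Completion (K := K) v)) (muVal K n (b₀ x)),
    (hb₀lc.comp (muVal K n)).comp _, fun x y => ?_⟩
  have h := hb₀ x y
  rw [contTwoCocycles.pullback_apply] at h
  change c.1 (absGaloisRestrict K (Place.Completion (K := K) v) x, absGaloisRestrict K (Place.Completion (K := K) v) y) =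
    mu K n (absGaloisRestrict K (Place.Completion (K := K) v) x) (b₀ y) - b₀ (x * y) + b₀ x at h
  rw [h, muVal_add, muVal_sub, muVal_apply, map_mul, map_div]
  refine Units.ext ?_
  simp only [Units.val_mul, Units.val_div_eq_div_val, Units.coe_map, MonoidHom.coe_coe, Units.coe_smul]
  rw [absGaloisRestrict_apply_smul]
  ring

omit [NeZero n] in
/-- Finite places: `exists_local_cochain_of_localization_twoCocycleClass_eq_zero` in the shape of the
hypothesis `hfin` of `twoCocycle_cob_of_locallyTrivial`. [cite: SerreGaloisCohomology1997, I §2.3] -/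
theorem exists_local_cochain_of_localization_twoCocycleClass_eq_zero_inr
    (c : contTwoCocycles (mu K n).toTopRep) (v : HeightOneSpectrum (𝓞 K))
    (hv : galoisCohomology.localization (mu K n) (Sum.inr v) 2
      (haveI : CompactSpace (absoluteGaloisGroup K) := absoluteGaloisGroup_compactSpace K
       twoCocycleClass (mu K n).toTopRep c) = 0) :
    ∃ b : absoluteGaloisGroup (v.adicCompletion K) → (AlgebraicClosure (v.adicCompletion K))ˣ,
      IsLocallyConstant b ∧ ∀ x y,
        Units.map (absClosureEmbedding K (v.adicCompletion K) :
            AlgebraicClosure K →* AlgebraicClosure (v.adicCompletion K))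
          (muVal K n (c.1 (absGaloisRestrict K (v.adicCompletion K) x, absGaloisRestrict K (v.adicCompletion K) y))) =
        b x * x • b y / b (x * y) :=
  exists_local_cochain_of_localization_twoCocycleClass_eq_zero c (Sum.inr v) hv

omit [NeZero n] in
/-- Infinite places: `exists_local_cochain_of_localization_twoCocycleClass_eq_zero` in the shape of the
hypothesis `hinf` of `twoCocycle_cob_of_locallyTrivial`. [cite: SerreGaloisCohomology1997, I §2.3] -/
theorem exists_local_cochain_of_localization_twoCocycleClass_eq_zero_inl
    (c : contTwoCocycles (mu K n).toTopRep) (w : InfinitePlace K)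
    (hw : galoisCohomology.localization (mu K n) (Sum.inl w) 2
      (haveI : CompactSpace (absoluteGaloisGroup K) := absoluteGaloisGroup_compactSpace K
       twoCocycleClass (mu K n).toTopRep c) = 0) :
    ∃ b : absoluteGaloisGroup w.Completion → (AlgebraicClosure w.Completion)ˣ,
      IsLocallyConstant b ∧ ∀ x y,
        Units.map (absClosureEmbedding K w.Completion : AlgebraicClosure K →* AlgebraicClosure w.Completion)
          (muVal K n (c.1 (absGaloisRestrict K w.Completion x, absGaloisRestrict K w.Completion y))) =
        b x * x • b y / b (x * y) :=
  exists_local_cochain_of_localization_twoCocycleClass_eq_zero c (Sum.inl w) hw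

/-- **`Ш²(K, μₙ) = 0`**: a class of `H²(K, μₙ)` (`n ≥ 1`, `K` a number field) whose localisation
vanishes at every finite and every infinite place is zero — Brauer–Hasse–Noether for `Br(K)[n] = H²(K, μₙ)`
(Hilbert 90).  The `r = 2`, `M = μₙ` instance of Poitou–Tate's `Ш²(K, M) ≅ Ш¹(K, M^D)^*` (with
`Ш¹(K, ℤ/n) = 0`).  [cite: CasselsFrohlichANT1967, Ch. VII §9.6 and §10] [cite: MilneADT2006, Ch. I, Thm. 4.10] -/
theorem galoisCohomology_mu_two_eq_zero_of_localization_eq_zero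
    (x : galoisCohomology (mu K n) 2)
    (hfin : ∀ v : HeightOneSpectrum (𝓞 K), galoisCohomology.localization (mu K n) (Sum.inr v) 2 x = 0)
    (hinf : ∀ w : InfinitePlace K, galoisCohomology.localization (mu K n) (Sum.inl w) 2 x = 0) :
    x = 0 := by
  haveI : CompactSpace (absoluteGaloisGroup K) := absoluteGaloisGroup_compactSpace K
  obtain ⟨c, rfl⟩ := twoCocycleClass_surjective (mu K n).toTopRep x
  -- the unit-valued cocycle `e = muVal ∘ c`
  set e : absoluteGaloisGroup K → absoluteGaloisGroup K → (AlgebraicClosure K)ˣ :=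
    fun σ τ => muVal K n (c.1 (σ, τ)) with he
  have hlc : IsLocallyConstant fun p : absoluteGaloisGroup K × absoluteGaloisGroup K => e p.1 p.2 :=
    ((IsLocallyConstant.iff_continuous _).2 c.1.continuous).comp (muVal K n)
  have hcoc : ∀ σ τ υ, e σ τ * e (σ * τ) υ = σ • e τ υ * e σ (τ * υ) := by
    intro σ τ υ
    have h := congrArg (muVal K n) ((mem_contTwoCocycles_iff _).1 c.2 σ τ υ)
    rw [muVal_add, muVal_add, ContinuousRep.toTopRep_ρ_apply, muVal_apply] at h
    change muVal K n (c.1 (σ, τ)) * muVal K n (c.1 (σ * τ, υ)) =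
      σ • muVal K n (c.1 (τ, υ)) * muVal K n (c.1 (σ, τ * υ))
    rw [h, mul_comm]
  -- Brauer–Hasse–Noether: `e = ∂b`
  obtain ⟨b, hb, hcob⟩ := twoCocycle_cob_of_locallyTrivial e hlc hcoc
    (fun v => exists_local_cochain_of_localization_twoCocycleClass_eq_zero_inr c v (hfin v))
    (fun w => exists_local_cochain_of_localization_twoCocycleClass_eq_zero_inl c w (hinf w))
  -- `eⁿ = 1`, so `σ ↦ b(σ)ⁿ` is a `1`-cocycle; Hilbert 90
  have hen : ∀ σ τ, (e σ τ) ^ n = 1 := fun σ τ => muVal_pow_eq_one K n _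
  have hpow : ∀ σ τ, b (σ * τ) ^ n = b σ ^ n * σ • b τ ^ n := by
    intro σ τ
    have h1 : b (σ * τ) = b σ * σ • b τ / e σ τ := by
      rw [hcob σ τ, div_div_cancel]
    rw [h1, div_pow, hen, div_one, mul_pow, smul_pow']
  obtain ⟨β, hβ0, hβ⟩ := absoluteGaloisGroup.exists_eq_smul_div_of_isLocallyConstant_cocycle K
    (c := fun σ => ((b σ ^ n : (AlgebraicClosure K)ˣ) : AlgebraicClosure K))
    ((hb.comp fun u : (AlgebraicClosure K)ˣ => ((u ^ n : (AlgebraicClosure K)ˣ) : AlgebraicClosure K)))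
    (fun σ => (b σ ^ n).ne_zero) (fun σ τ => by rw [hpow, Units.val_mul, Units.coe_smul])
  -- an `n`-th root `α` of `β`
  obtain ⟨α, hα⟩ := IsAlgClosed.exists_pow_nat_eq β (NeZero.pos n)
  have hα0 : α ≠ 0 := by
    rintro rfl
    rw [zero_pow (NeZero.ne n)] at hα
    exact hβ0 hα.symm
  set αu : (AlgebraicClosure K)ˣ := Units.mk0 α hα0 with hαu
  have hαn : αu ^ n = Units.mk0 β hβ0 := Units.ext (by rw [Units.val_pow_eq_pow_val, Units.val_mk0, Units.val_mk0, hα])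
  have hbn : ∀ σ, b σ ^ n = σ • Units.mk0 β hβ0 / Units.mk0 β hβ0 := fun σ =>
    Units.ext (by rw [Units.val_div_eq_div_val, Units.coe_smul, Units.val_mk0]; exact hβ σ)
  -- the `μₙ`-valued cochain `b' σ = b σ · α / σα`
  have hroot : ∀ σ, b σ * αu / σ • αu ∈ rootsOfUnity n (AlgebraicClosure K) := by
    intro σ
    rw [mem_rootsOfUnity, div_pow, mul_pow, ← smul_pow', hαn, hbn, div_mul_cancel, div_self']
  let B : absoluteGaloisGroup K → MuCarrier K n := fun σ => MuCarrier.ofRootsOfUnity ⟨_, hroot σ⟩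
  have hB : ∀ σ, muVal K n (B σ) = b σ * αu / σ • αu := fun σ => rfl
  have hBlc : IsLocallyConstant B := by
    refine IsLocallyConstant.desc B (muVal K n) ?_ (muVal_injective K n)
    have h1 : (muVal K n ∘ B) = fun σ => b σ * αu / σ • αu := funext fun σ => hB σ
    rw [h1]
    exact (hb.mul (IsLocallyConstant.const αu)).div (isLocallyConstant_smul_units K αu)
  -- `[c] = 0`: `c = ∂B`
  refine (twoCocycleClass_eq_zero_iff _ c).2 ⟨⟨B, hBlc.continuous⟩, fun σ τ => ?_⟩
  apply muVal_injective K n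
  change muVal K n (c.1 (σ, τ)) = muVal K n ((mu K n) σ (B τ) - B (σ * τ) + B σ)
  rw [muVal_add, muVal_sub, muVal_apply, hB, hB, hB, smul_div', smul_mul', ← mul_smul]
  change e σ τ = _
  rw [hcob σ τ, coboundary_identity]

end Summit.BirchSwinnertonDyer.BirchSwinnertonDyer.Theorems.SchneiderFreeAdditiveX3.PoitouTateReduction

end
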